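import Literature.Computability.AlgebraicComplexity.CwSquareFlattening
import HarnessLib

/-!
# Koszul flattenings of Kronecker powers of `T_{cw,q}`: the entry formula (any `N`, any `p`, any `q`)

Topic: `Literature/Computability/AlgebraicComplexity`.  Support for the cube case of
Conner–Gesmundo–Landsberg–Ventura 2022, Thm. 1.2 (`CGLV2022_thm12_cube` in `BorderRankCW.lean`:
`bR(T_{cw,q}^{⊠3}) = (q+2)³` for `q > 4`), whose lower bound is a `p = 2` Koszul-flattening bound
(CGLV §3, eq. (8), and Thm. 3.4).  `CwSquareFlattening.lean` makes the flattenings of the SQUARE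
explicit (`cwAlpha`, `phiVal`, `koszulFlattening_cwSq_apply`) and
`BorderRankCWKoszulRanksCubeTwoProofs.lean` those of the cube of `T_{cw,2}`; this file does the same
uniformly for every Kronecker power `T_{cw,q}^{⊠N}` on the index types `Fin N → Fin (q+1)` of the
tree's `kroneckerPow`, so that the `q`-uniform argument for the cube (`CwCubeDeadLabels.lean`) and its
kernel certificates can share one entry formula.  Everything here is PROVED; no facts.

* `cwAlphaPow q N b c` — the unique `a ∈ A^{⊗N}` with `(T_{cw,q}^{⊠N})_{abc} = 1` (factorwise
  `cwAlpha`), if every factor is defined, else `none`; `cwAlphaPow_eq_some_iff`;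
  `kroneckerPow_cwTensor_eq : (T_{cw,q}^{⊠N})_{abc} = [cwAlphaPow q N b c = some a]`.
* `powPhiVal M j b c = M_{j, α(b,c)}` — the slice entry of the restricted power `(M ⊗ 1 ⊗ 1) T^{⊠N}`
  (`sum_mul_kroneckerPow_cwTensor`), and the ENTRY FORMULA `koszulFlattening_cwPow_apply`:
  `K_M(T_{cw,q}^{⊠N})((T,c),(S,b)) = ∑_j [j ∉ S, T = S ∪ j] ε(S,j) M_{j, α(b,c)}`.
* Vanishing: `powPhiVal_of_none`, `koszulFlattening_cwPow_eq_zero_of_cwAlpha_eq_none` (an entry is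
  zero as soon as one factor `(b_l, c_l)` is not in the support pattern of `T_{cw,q}`), and
  `exists_of_koszulFlattening_cwPow_ne_zero` (a non-zero entry exhibits `j` and `a = α(b,c)` with
  `T = S ∪ j` and `M_{j a} ≠ 0`).
* Base change: `kroneckerPow_cwTensor_intCast`, `koszulFlattening_cwPow_intCast`.
* `cwAlpha_some_cases`, `cwAlpha_self` — the three shapes of a defined `α(b, c)`.

## References

* A. Conner, F. Gesmundo, J. M. Landsberg, E. Ventura, *Rank and border rank of Kronecker powers of
  tensors and Strassen's laser method*, comput. complexity 31 (2022) = arXiv:1909.04785v2, eq. (1)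
  (`T_{cw,q}`), §3 eq. (8) and the proofs of Thms. 3.3–3.4 (Koszul flattenings of `T_{cw,q}^{⊠N}`
  after a restriction `A^{⊗N} → A'`). [ConnerGesmundoLandsbergVentura2022]
-/

open scoped BigOperators
open Matrix

namespace Literature.Computability.AlgebraicComplexity

/-! ## The support function of `T_{cw,q}^{⊠N}` -/

section AlphaPow

variable {q N : ℕ}

/-- The three shapes of a defined `α(b,c)`: `b = c ≠ 0` (then `α = 0`), `b = 0 ≠ c` (`α = c`),
`c = 0 ≠ b` (`α = b`). [cite: ConnerGesmundoLandsbergVentura2022, eq. (1)] -/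
theorem cwAlpha_some_cases {b c a : Fin (q + 1)} (h : cwAlpha q b c = some a) :
    (a = 0 ∧ b = c ∧ b ≠ 0) ∨ (b = 0 ∧ c ≠ 0 ∧ a = c) ∨ (c = 0 ∧ b ≠ 0 ∧ a = b) := by
  unfold cwAlpha at h
  split_ifs at h with h1 h2 h3
  · left; exact ⟨(Option.some.inj h).symm, h1.1, h1.2⟩
  · right; left; exact ⟨h2.1, h2.2, (Option.some.inj h).symm⟩
  · right; right; exact ⟨h3.1, h3.2, (Option.some.inj h).symm⟩

/-- `α(b, b) = 0` for `b ≠ 0` (the term `a₀ ⊗ b_j ⊗ c_j`). [cite: ConnerGesmundoLandsbergVentura2022, eq. (1)] -/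
theorem cwAlpha_self {b : Fin (q + 1)} (hb : b ≠ 0) : cwAlpha q b b = some 0 := by
  unfold cwAlpha
  rw [if_pos ⟨rfl, hb⟩]

/-- `α(b, c)` is undefined when `b ≠ c` are both non-zero. [cite: ConnerGesmundoLandsbergVentura2022, eq. (1)] -/
theorem cwAlpha_eq_none {b c : Fin (q + 1)} (hbc : b ≠ c) (hb : b ≠ 0) (hc : c ≠ 0) :
    cwAlpha q b c = none := by
  unfold cwAlpha
  rw [if_neg (fun h => hbc h.1), if_neg (fun h => hb h.1), if_neg (fun h => hc h.1)]

/-- `α(0, 0)` is undefined. [cite: ConnerGesmundoLandsbergVentura2022, eq. (1)] -/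
theorem cwAlpha_zero_zero : cwAlpha q 0 0 = none := by
  unfold cwAlpha
  simp

/-- The support function of the Kronecker power: `cwAlphaPow q N b c = some a` with
`a_l = α(b_l, c_l)` if all `N` factors are defined, else `none`.
[cite: ConnerGesmundoLandsbergVentura2022, eq. (1)] -/
def cwAlphaPow (q N : ℕ) (b c : Fin N → Fin (q + 1)) : Option (Fin N → Fin (q + 1)) :=
  if h : ∀ l, (cwAlpha q (b l) (c l)).isSome then
    some (fun l => (cwAlpha q (b l) (c l)).get (h l))
  else none

/-- `cwAlphaPow q N b c = some a` iff `α(b_l, c_l) = a_l` for every factor `l`.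
[cite: ConnerGesmundoLandsbergVentura2022, eq. (1)] -/
theorem cwAlphaPow_eq_some_iff {b c a : Fin N → Fin (q + 1)} :
    cwAlphaPow q N b c = some a ↔ ∀ l, cwAlpha q (b l) (c l) = some (a l) := by
  unfold cwAlphaPow
  split_ifs with h
  · rw [Option.some.injEq]
    constructor
    · rintro rfl l
      exact (Option.some_get (h l)).symm
    · intro hl
      funext l
      exact Option.get_of_mem (h l) (hl l)
  · constructor
    · intro h0; exact absurd h0 (by simp)
    · intro hl
      exact absurd (fun l => by rw [hl l]; rfl) h

/-- `cwAlphaPow q N b c = none` iff some factor is undefined.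
[cite: ConnerGesmundoLandsbergVentura2022, eq. (1)] -/
theorem cwAlphaPow_eq_none_iff {b c : Fin N → Fin (q + 1)} :
    cwAlphaPow q N b c = none ↔ ∃ l, cwAlpha q (b l) (c l) = none := by
  unfold cwAlphaPow
  split_ifs with h
  · simp only [false_iff, not_exists]
    intro l hl
    have := h l
    rw [hl] at this
    exact absurd this (by simp)
  · simp only [true_iff]
    by_contra hne
    push Not at hne
    exact h fun l => Option.ne_none_iff_isSome.1 (hne l)

variable (R : Type*) [CommSemiring R]

/-- **Support of the Kronecker power**: `(T_{cw,q}^{⊠N})_{abc} = [cwAlphaPow q N b c = some a]`.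
[cite: ConnerGesmundoLandsbergVentura2022, eq. (1)] -/
theorem kroneckerPow_cwTensor_eq (a b c : Fin N → Fin (q + 1)) :
    kroneckerPow (cwTensor R q) N a b c = if cwAlphaPow q N b c = some a then 1 else 0 := by
  simp only [kroneckerPow_apply, cwTensor_eq_ite_cwAlpha]
  by_cases h : cwAlphaPow q N b c = some a
  · rw [if_pos h]
    rw [cwAlphaPow_eq_some_iff] at h
    exact Finset.prod_eq_one fun l _ => by rw [if_pos (h l)]
  · rw [if_neg h]
    rw [cwAlphaPow_eq_some_iff] at h
    push Not at h
    obtain ⟨l, hl⟩ := h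
    exact Finset.prod_eq_zero (Finset.mem_univ l) (by rw [if_neg hl])

/-- The integer power casts to the power over any commutative ring. [folklore] -/
theorem kroneckerPow_cwTensor_intCast (S : Type*) [CommRing S] (a b c : Fin N → Fin (q + 1)) :
    ((kroneckerPow (cwTensor ℤ q) N a b c : ℤ) : S) = kroneckerPow (cwTensor S q) N a b c := by
  rw [kroneckerPow_cwTensor_eq, kroneckerPow_cwTensor_eq]
  split_ifs <;> simp

end AlphaPow

/-! ## Slices of the restricted power and the entries of its Koszul flattenings -/

section Entries

variable {R : Type*} [CommSemiring R] {q N m : ℕ}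

/-- The slice entry `X_j(b, c) = M_{j, α(b,c)}` of the restricted power `(M ⊗ 1 ⊗ 1) T_{cw,q}^{⊠N}`
(zero if `α(b, c)` is undefined). [cite: ConnerGesmundoLandsbergVentura2022, §3 (proof of Thm. 3.4)] -/
def powPhiVal (M : Matrix (Fin m) (Fin N → Fin (q + 1)) R) (j : Fin m) (b c : Fin N → Fin (q + 1)) : R :=
  match cwAlphaPow q N b c with
  | some a => M j a
  | none => 0

/-- `X_j(b, c) = M_{j a}` when `α(b, c) = a`. [cite: ConnerGesmundoLandsbergVentura2022, §3 (proof of Thm. 3.4)] -/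
theorem powPhiVal_of_some (M : Matrix (Fin m) (Fin N → Fin (q + 1)) R) (j : Fin m)
    {b c a : Fin N → Fin (q + 1)} (h : cwAlphaPow q N b c = some a) : powPhiVal M j b c = M j a := by
  simp [powPhiVal, h]

/-- `X_j(b, c) = 0` when `α(b, c)` is undefined. [cite: ConnerGesmundoLandsbergVentura2022, §3 (proof of Thm. 3.4)] -/
theorem powPhiVal_of_none (M : Matrix (Fin m) (Fin N → Fin (q + 1)) R) (j : Fin m)
    {b c : Fin N → Fin (q + 1)} (h : cwAlphaPow q N b c = none) : powPhiVal M j b c = 0 := by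
  simp [powPhiVal, h]

/-- `X_j(b, c) = 0` as soon as one factor `(b_l, c_l)` is off the support pattern of `T_{cw,q}`.
[cite: ConnerGesmundoLandsbergVentura2022, §3 (proof of Thm. 3.4)] -/
theorem powPhiVal_eq_zero_of_cwAlpha_eq_none (M : Matrix (Fin m) (Fin N → Fin (q + 1)) R) (j : Fin m)
    {b c : Fin N → Fin (q + 1)} {l : Fin N} (h : cwAlpha q (b l) (c l) = none) : powPhiVal M j b c = 0 :=
  powPhiVal_of_none M j (cwAlphaPow_eq_none_iff.2 ⟨l, h⟩)

/-- **Slice formula**: `∑_a M_{ja} (T_{cw,q}^{⊠N})_{abc} = X_j(b, c)`.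
[cite: ConnerGesmundoLandsbergVentura2022, §3 (proof of Thm. 3.4)] -/
theorem sum_mul_kroneckerPow_cwTensor (M : Matrix (Fin m) (Fin N → Fin (q + 1)) R) (j : Fin m)
    (b c : Fin N → Fin (q + 1)) :
    ∑ a, M j a * kroneckerPow (cwTensor R q) N a b c = powPhiVal M j b c := by
  simp_rw [kroneckerPow_cwTensor_eq, mul_ite, mul_one, mul_zero]
  rcases h : cwAlphaPow q N b c with _ | a₀
  · rw [powPhiVal_of_none M j h]
    simp
  · rw [powPhiVal_of_some M j h]
    simp only [Option.some.injEq]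
    rw [Finset.sum_ite_eq]
    simp

variable {S : Type*} [CommRing S]

/-- **Entry formula** for the Koszul flattening (any `p`) of the restricted power
`(M ⊗ 1 ⊗ 1) T_{cw,q}^{⊠N}`, row `(T, c)`, column `(S, b)`:
`K = ∑_j [j ∉ S, T = S ∪ j] ε(S, j) X_j(b, c)`. [cite: ConnerGesmundoLandsbergVentura2022, §3 eq. (8)] -/
theorem koszulFlattening_cwPow_apply (p : ℕ) (M : Matrix (Fin (2 * p + 1)) (Fin N → Fin (q + 1)) S)
    (r : PSub (2 * p + 1) (p + 1) × (Fin N → Fin (q + 1)))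
    (c : PSub (2 * p + 1) p × (Fin N → Fin (q + 1))) :
    koszulFlattening p M.mulVecLin (kroneckerPow (cwTensor S q) N) r c =
      ∑ j, (if j ∉ c.1.1 ∧ r.1.1 = insert j c.1.1 then (koszulSign c.1.1 j : S) else 0) *
        powPhiVal M j c.2 r.2 := by
  rw [koszulFlattening_apply, wedgeMatrix_apply]
  refine Finset.sum_congr rfl fun j _ => ?_
  split_ifs
  · rw [Matrix.mulVecLin_apply, Matrix.mulVec, dotProduct, sum_mul_kroneckerPow_cwTensor]
  · rw [zero_mul]

/-- An entry vanishes as soon as one factor `(b_l, c_l)` of its column/row labels is off the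
support pattern of `T_{cw,q}` (`b_l = c_l ≠ 0`, `b_l = 0 ≠ c_l` or `c_l = 0 ≠ b_l`).
[cite: ConnerGesmundoLandsbergVentura2022, §3 (proof of Thm. 3.4)] -/
theorem koszulFlattening_cwPow_eq_zero_of_cwAlpha_eq_none (p : ℕ)
    (M : Matrix (Fin (2 * p + 1)) (Fin N → Fin (q + 1)) S)
    (r : PSub (2 * p + 1) (p + 1) × (Fin N → Fin (q + 1)))
    (c : PSub (2 * p + 1) p × (Fin N → Fin (q + 1))) {l : Fin N}
    (h : cwAlpha q (c.2 l) (r.2 l) = none) :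
    koszulFlattening p M.mulVecLin (kroneckerPow (cwTensor S q) N) r c = 0 := by
  rw [koszulFlattening_cwPow_apply]
  exact Finset.sum_eq_zero fun j _ => by
    rw [powPhiVal_eq_zero_of_cwAlpha_eq_none M j h, mul_zero]

/-- A non-zero entry exhibits its unique contributing slice: `j ∉ S` with `T = S ∪ j`, and
`a = α(b, c)` with `M_{j a} ≠ 0`. [cite: ConnerGesmundoLandsbergVentura2022, §3 (proof of Thm. 3.4)] -/
theorem exists_of_koszulFlattening_cwPow_ne_zero (p : ℕ)
    (M : Matrix (Fin (2 * p + 1)) (Fin N → Fin (q + 1)) S)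
    (r : PSub (2 * p + 1) (p + 1) × (Fin N → Fin (q + 1)))
    (c : PSub (2 * p + 1) p × (Fin N → Fin (q + 1)))
    (h : koszulFlattening p M.mulVecLin (kroneckerPow (cwTensor S q) N) r c ≠ 0) :
    ∃ j a, j ∉ c.1.1 ∧ r.1.1 = insert j c.1.1 ∧ cwAlphaPow q N c.2 r.2 = some a ∧ M j a ≠ 0 := by
  rw [koszulFlattening_cwPow_apply] at h
  obtain ⟨j, -, hj⟩ := Finset.exists_ne_zero_of_sum_ne_zero h
  have hinc : j ∉ c.1.1 ∧ r.1.1 = insert j c.1.1 := by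
    by_contra hne
    rw [if_neg hne, zero_mul] at hj
    exact hj rfl
  have hφ : powPhiVal M j c.2 r.2 ≠ 0 := fun h0 => hj (by rw [h0, mul_zero])
  rcases hbc : cwAlphaPow q N c.2 r.2 with _ | a
  · exact absurd (powPhiVal_of_none M j hbc) hφ
  · exact ⟨j, a, hinc.1, hinc.2, rfl, by rwa [powPhiVal_of_some M j hbc] at hφ⟩

/-- Base change `ℤ → S` of the Koszul flattening of the restricted power.
[cite: ConnerGesmundoLandsbergVentura2022, §3 eq. (8)] -/
theorem koszulFlattening_cwPow_intCast (p : ℕ) (M : Matrix (Fin (2 * p + 1)) (Fin N → Fin (q + 1)) ℤ) :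
    koszulFlattening p (M.map (Int.castRingHom S)).mulVecLin (kroneckerPow (cwTensor S q) N) =
      (koszulFlattening p M.mulVecLin (kroneckerPow (cwTensor ℤ q) N)).map (Int.castRingHom S) := by
  rw [koszulFlattening_map]
  congr 1
  funext a b c
  exact (kroneckerPow_cwTensor_intCast S a b c).symm

end Entries

end Literature.Computability.AlgebraicComplexity
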